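import Summits.RiemannHypothesis.RiemannHypothesis.Theorems.PfPersistenceRatioBandGuarded
import Summits.RiemannHypothesis.RiemannHypothesis.Theorems.PfPersistenceF1SupersetRigidity
import Summits.RiemannHypothesis.RiemannHypothesis.Theorems.PfPersistenceDimensionOneWindows
import Summits.RiemannHypothesis.RiemannHypothesis.Theorems.PfPersistenceBarrierRealPair
import Summits.RiemannHypothesis.RiemannHypothesis.Theorems.PfPersistenceArithDialSpace
import Summits.RiemannHypothesis.RiemannHypothesis.Theorems.PfPersistenceGapClassG1
import Summits.RiemannHypothesis.RiemannHypothesis.Theorems.PfPersistenceInWindowMirror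
import Summits.RiemannHypothesis.RiemannHypothesis.Theorems.PfPersistenceSecondLevel

/-!
# Runbook sanity lemmas — pf-persistence cell (`pub-rhpf`), REVIEW-RUNBOOK §2 definition cards

Sanity lemmas of kinds (a) agreement with the Mathlib notion and (b) inhabitedness / non-vacuity (one instance where a
predicate holds, one where it fails; small computed values of data definitions) for the project definitions under the
eight headline theorems of `papers/RiemannHypothesis/pf-persistence` (runbook generated by `harness/kit/review_runbook.py`,
ops-runbook seat).  Each lemma is listed on the corresponding definition card with its proposal id.

Main agreement lemma: `gMangoldt_primeIndicator` — the generalised von Mangoldt function of the integer g-prime system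
"every prime once, nothing else" (`m = 𝟙_ℙ`) IS Mathlib's `ArithmeticFunction.vonMangoldt`; hence `gTable 𝟙_ℙ = zetaWeights`
(`gTable_primeIndicator`): the fake-prime dictionary of `PfPersistenceF1Beurling` specialises to `ζ`'s weight table at the true primes.
-/

set_option linter.dupNamespace false  -- the mandated namespace repeats `RiemannHypothesis` (as in every file of the cell)

namespace Summit.RiemannHypothesis.RiemannHypothesis.Runbook

open Summit.RiemannHypothesis.RiemannHypothesis.Theorems.PfPersistence
open Summit.RiemannHypothesis.RiemannHypothesis.Theorems

/-! ## Windows, data space, weight tables (cards `Window`, `Datum`, `Weights`, `below`) -/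

/-- `Window` is inhabited: the unit window `a = 1`, `N = 0` meets the guard `0 < a`. [folklore] -/
theorem nonempty_window : Nonempty Window := ⟨⟨1, 0, one_pos⟩⟩

/-- The data space `Datum` (a real matrix at every window) is inhabited — e.g. by `ζ`'s datum. [folklore] -/
theorem nonempty_datum : Nonempty Datum := ⟨zetaDatum⟩

/-- The weight tables `Weights = ℕ → ℝ` are inhabited — e.g. by `ζ`'s table `Λ(q) q^{-1/2}`. [folklore] -/
theorem nonempty_weights : Nonempty Weights := ⟨zetaWeights⟩

/-- (b) `below A` holds somewhere: the unit window `⟨1, 0, _⟩` has height `1 ≤ 1`. [folklore] -/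
theorem unitWindow_mem_below_one : (⟨1, 0, one_pos⟩ : Window) ∈ below 1 := by
  show (1 : ℝ) ≤ 1
  exact le_rfl

/-- (b) `below A` fails somewhere: the unit window is not of height `≤ 1/2`. [folklore] -/
theorem unitWindow_not_mem_below_half : (⟨1, 0, one_pos⟩ : Window) ∉ below (1 / 2) := by
  show ¬ ((1 : ℝ) ≤ 1 / 2)
  norm_num

/-- (b) `below` is monotone in the height bound. [folklore] -/
theorem below_mono {A B : ℝ} (h : A ≤ B) : below A ⊆ below B :=
  fun _ hw => le_trans (show _ ≤ A from hw) h

/-! ## Positivity of a window matrix (card `WindowPositive`) -/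

/-- (b) `WindowPositive` holds for the zero matrix (every Rayleigh numerator is `0`). [folklore] -/
theorem windowPositive_zero (n : ℕ) : WindowPositive (0 : Matrix (Fin n) (Fin n) ℝ) := by
  intro v
  simp [Matrix.zero_mulVec]

/-- (b) `WindowPositive` fails for the `1 × 1` matrix `(-1)`. [folklore] -/
theorem not_windowPositive_neg_one : ¬ WindowPositive (-(1 : Matrix (Fin 1) (Fin 1) ℝ)) := by
  rw [windowPositive_fin_one_iff]
  norm_num

/-! ## Arithmetic weight tables and the arithmetic dial space (cards `arithWeights`, `shiftDial`, `shift`; the cell's own `zetaWeights_mem_arithWeights`,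
`zetaDatum_mem_arithDialSpace`, `shift_zetaDatum_not_mem_arithDialSpace` are the holds/fails witnesses of `arithWeights` / `arithDialSpace`) -/

/-- (b) the constant table `1` is NOT arithmetic (it charges `q = 0`, which is not a prime power). [folklore] -/
theorem one_not_mem_arithWeights : (fun _ => (1 : ℝ)) ∉ arithWeights := by
  intro h
  have := h 0 not_isPrimePow_zero
  norm_num at this

/-- (b) the shift family at `δ = 0` is the identity: `shift 0 d = d`. [folklore] -/
theorem shift_zero_eq (d : Datum) : shift 0 d = d := by
  funext win
  simp [shift]

/-- (b) hence `shiftDial 0 = zetaDatum`. [folklore] -/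
theorem shiftDial_zero : shiftDial 0 = zetaDatum := shift_zero_eq zetaDatum

/-! ## Band-guarded gauge-ratio class (card `GaugeRatioClassBand`) -/

/-- (b)/(scope) DEGENERATE BAND: if `amax < amin` the band condition is vacuous and EVERY datum lies in
`GaugeRatioClassBand amin amax τ` — non-vacuity of the class requires `amin ≤ amax` (the headline theorem
`not_separates_gaugeRatioClassBand` is to be read with a genuine band). [folklore] -/
theorem mem_gaugeRatioClassBand_of_band_empty {amin amax : ℝ} (h : amax < amin) (τ : ℝ) (d : Datum) :
    d ∈ GaugeRatioClassBand amin amax τ := by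
  intro win h1 h2 _
  exact absurd (lt_of_lt_of_le (lt_of_le_of_lt h2 h) h1) (lt_irrefl _)

/-! ## Even tests (card `PfPersistenceBarrier.IsEven`) -/

/-- (b) `IsEven` holds for `t ↦ t²`. [folklore] -/
theorem isEven_sq : PfPersistenceBarrier.IsEven (fun t : ℝ => ((t : ℂ) ^ 2)) := by
  intro t
  push_cast
  ring

/-- (b) `IsEven` fails for the identity `t ↦ t`. [folklore] -/
theorem not_isEven_id : ¬ PfPersistenceBarrier.IsEven (fun t : ℝ => (t : ℂ)) := by
  intro h
  have := h 1
  norm_num at this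

/-! ## g-prime systems (cards `ContainsPrimes`, `LocallyFiniteSystem`, `gMangoldt`, `gTable`, `beurlingDatum`) -/

open Fake1 Fake1.SupersetRigidity

/-- The integer g-prime system "every natural number is a slot with `g i = i`, multiplicity one": it contains the primes. [folklore] -/
theorem containsPrimes_id_one : ContainsPrimes (fun i => (i : ℝ)) (fun _ => 1) :=
  fun p _ => ⟨p, rfl, le_rfl⟩

/-- (b) `ContainsPrimes` fails for the empty system (all multiplicities `0`). [folklore] -/
theorem not_containsPrimes_zero (g : ℕ → ℝ) : ¬ ContainsPrimes g (fun _ => 0) := by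
  intro h
  obtain ⟨i, -, hi⟩ := h 2 Nat.prime_two
  exact absurd hi (by norm_num)

/-- (b) the empty system is locally finite. [folklore] -/
theorem locallyFiniteSystem_zero (g : ℕ → ℝ) : LocallyFiniteSystem g (fun _ => 0) := by
  intro X
  simp

/-- (b) the system `g i = i` with multiplicity one is locally finite (finitely many `i ≤ X`). [folklore] -/
theorem locallyFiniteSystem_id_one : LocallyFiniteSystem (fun i => (i : ℝ)) (fun _ => 1) := by
  intro X
  refine (Set.finite_Iic ⌈X⌉₊).subset ?_
  rintro i ⟨hi, -⟩
  exact Nat.cast_le.1 (hi.trans (Nat.le_ceil X))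

/-- (b) `LocallyFiniteSystem` fails when infinitely many used slots sit at one position (`g ≡ 0`, `m ≡ 1`). [folklore] -/
theorem not_locallyFiniteSystem_const : ¬ LocallyFiniteSystem (fun _ => (0 : ℝ)) (fun _ => 1) := by
  intro h
  have h0 := h 0
  simp only [le_refl, ne_eq, one_ne_zero, not_false_eq_true, and_self, Set.setOf_true] at h0
  exact Set.infinite_univ h0

/-- (b) `gMangoldt m 0 = 0` and `gMangoldt m 1 = 0` (no g-prime power is `0` or `1`). [folklore] -/
theorem gMangoldt_zero_one (m : ℕ → ℕ) : gMangoldt m 0 = 0 ∧ gMangoldt m 1 = 0 := by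
  constructor <;> simp [gMangoldt]

/-- (a) AGREEMENT WITH MATHLIB: for the g-prime system `𝟙_ℙ` (each rational prime once, nothing else) the generalised
von Mangoldt function `gMangoldt` is the von Mangoldt function `Λ` of Mathlib. [folklore] -/
theorem gMangoldt_primeIndicator (n : ℕ) :
    gMangoldt (fun g => if g.Prime then 1 else 0) n = ArithmeticFunction.vonMangoldt n := by
  classical
  rw [ArithmeticFunction.vonMangoldt_apply]
  unfold gMangoldt
  by_cases hn : IsPrimePow n
  · rw [if_pos hn]
    obtain ⟨p, k, hp, hk, rfl⟩ := (isPrimePow_nat_iff n).1 hn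
    have hp' : p.Prime := hp
    have hmin : (p ^ k).minFac = p := by
      rw [Nat.pow_minFac hk.ne', hp'.minFac_eq]
    rw [hmin]
    have hpk : p ≤ p ^ k := Nat.le_self_pow hk.ne' p
    have hkk : k ≤ p ^ k := (Nat.lt_two_pow_self).le.trans (Nat.pow_le_pow_left hp'.two_le k)
    rw [Finset.sum_eq_single p, Finset.sum_eq_single k]
    · simp [hp']
    · intro j _ hj
      rw [if_neg]
      exact fun h => hj (Nat.pow_right_injective hp'.two_le h)
    · intro h
      exact absurd (Finset.mem_Icc.2 ⟨hk, hkk⟩) h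
    · intro g _ hg
      refine Finset.sum_eq_zero fun j hj => ?_
      by_cases hgp : g.Prime
      · rw [if_neg]
        intro h
        have hj1 : 1 ≤ j := (Finset.mem_Icc.1 hj).1
        have : p ∣ g := by
          have : p ∣ g ^ j := by rw [h]; exact dvd_pow_self p hk.ne'
          exact hp'.dvd_of_dvd_pow this
        exact hg (((Nat.prime_dvd_prime_iff_eq hp' hgp).1 this).symm)
      · simp [hgp]
    · intro h
      exact absurd (Finset.mem_Icc.2 ⟨hp'.two_le, hpk⟩) h
  · rw [if_neg hn]
    refine Finset.sum_eq_zero fun g hg => Finset.sum_eq_zero fun j hj => ?_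
    by_cases hgp : g.Prime
    · rw [if_neg]
      intro h
      have hj1 : 0 < j := (Finset.mem_Icc.1 hj).1
      exact hn ((isPrimePow_nat_iff n).2 ⟨g, j, hgp, hj1, h⟩)
    · simp [hgp]

/-- (a) hence the weight table of the g-prime system `𝟙_ℙ` is `ζ`'s weight table `Λ(q) q^{-1/2}`. [folklore] -/
theorem gTable_primeIndicator : gTable (fun g => if g.Prime then 1 else 0) = zetaWeights := by
  funext n
  simp only [gTable, zetaWeights, gMangoldt_primeIndicator]

/-- (b) computed value: the point masses of `beurlingDatum g m` sit at `(k+1) · log (g i)` for the slot/exponent pair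
coded by `Nat.pair i k`. [folklore] -/
theorem beurlingDatum_pos_pair (g : ℕ → ℝ) (m : ℕ → ℕ) (i k : ℕ) :
    (beurlingDatum g m).pos (Nat.pair i k) = ((k : ℝ) + 1) * Real.log (g i) := by
  simp [beurlingDatum, Nat.unpair_pair]

/-! ## Explicit-formula data (cards `PfPersistenceBarrier.zetaDatum`, `zetaC`, `realPairDatum`, `ExplicitDatum`) -/

/-- (b) `ExplicitDatum` is inhabited by `ζ`'s datum; `Fake1.zetaC` is the same term. [folklore] -/
theorem zetaC_eq : Fake1.zetaC = PfPersistenceBarrier.zetaDatum := rfl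

/-- (b) computed values: the planted-real-pair datum keeps `ζ`'s point masses (positions and weights verbatim). [folklore] -/
theorem realPairDatum_pos_wt (η : ℝ) :
    (PfPersistenceBarrier.realPairDatum η).pos = PfPersistenceBarrier.zetaDatum.pos ∧
      (PfPersistenceBarrier.realPairDatum η).wt = PfPersistenceBarrier.zetaDatum.wt := ⟨rfl, rfl⟩

/-- (b) computed value: `ζ`'s explicit-formula masses sit at `log n`. [folklore] -/
theorem zetaDatum_pos (n : ℕ) : PfPersistenceBarrier.zetaDatum.pos n = Real.log n := rfl


/-! ## Joint satisfiability of the height-locality hypotheses (card S `not_separates_of_determinedOn_below_arith`, (b)) -/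

/-- (b) **The two hypotheses of `not_separates_of_determinedOn_below_arith` hold together, non-degenerately**
(review-runbook 2026-09-04, block «Joint satisfiability»): `D := arithDialSpace` (so `arithDialSpace ⊆ D`), `A := 1`, and
`S :=` «the `(0,0)` entry of the block at the window `(a, N) = (1, 0)` (`unitWindow_mem_below_one`) is `≥ 0`» — ONE finite test at height `1`, a set
DETERMINED ON `below 1` (two data agreeing on every window of height `≤ 1` agree at that window) which is neither `∅` nor
`univ`.  This is exactly the class the theorem addresses (a fixed family of tests at bounded height cannot separate `ζ`'s
datum from the arithmetic dial space). [folklore] -/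
theorem heightLocality_hypotheses :
    ∃ (S D : Set Datum) (A : ℝ), arithDialSpace ⊆ D ∧ DeterminedOn S (below A) :=
  ⟨{d | 0 ≤ d ⟨1, 0, one_pos⟩ 0 0}, arithDialSpace, 1, subset_rfl, fun d d' h => by
    simp only [Set.mem_setOf_eq]
    rw [h ⟨1, 0, one_pos⟩ unitWindow_mem_below_one]⟩

section Rayleigh

open scoped Matrix

/-! ## The Rayleigh infima / supremum behind `ε₁ = bottomRayleigh`, `ε₂ = secondRayleigh` are GENUINE
(review-runbook «inf» / «sup» side facts, appended 2026-09-05, gen 93)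

`bottomRayleigh M = sInf {r | ∃ v ≠ 0, r = vᵀMv / vᵀv}` and `secondRayleigh M = ⨆ u, sInf {r | ∃ v ≠ 0, v ⊥ u, r = vᵀMv / vᵀv}`.
Mathlib's `sInf` / `⨆` on `ℝ` return the DEFAULT `0` for an empty or unbounded set.  The cell proved the set facts under the
names `rayleighSet_bddBelow` / `rayleighSet_nonempty` (`PfPersistenceInWindowMirror.lean`) and `orthRayleighSet_bddBelow` /
`orthRayleighSet_nonempty` / `bddAbove_range_sInf_orthRayleighSet` (`PfPersistenceSecondLevel.lean`), for its named sets
`rayleighSet M` / `orthRayleighSet M u`; here they are restated for the sets WRITTEN in the two definitions, so that the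
runbook's side-fact reader finds them on the `bottomRayleigh` / `secondRayleigh` cards.  Dimension caveats, as proved:
every Rayleigh set is bounded below (by `−Σ|M i j|`) in every dimension; it is non-empty in POSITIVE dimension (`Fin (n + 1)`
— every window matrix of the cell is `(N+1) × (N+1)`); the orthogonal set is non-empty in dimension `≥ 2` (`0 < n`); the
`⨆` in `secondRayleigh` ranges over a set bounded above (by `Σ|M i j|`) in EVERY dimension (an empty inner set contributes
the default `0 ≤ Σ|M i j|`).  For a `0 × 0` matrix `bottomRayleigh = 0` and for a `1 × 1` matrix `secondRayleigh` is the
junk `max (M 0 0) 0` (`secondRayleigh_fin_one` in the tree) — neither occurs at a window of the cell. -/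

/-- (c) **The Rayleigh set of `bottomRayleigh M` is bounded below** — in every dimension, by `−Σ|M i j|` (the cell's
`rayleighSet_bddBelow`, stated for the set as written in `bottomRayleigh`). [folklore] -/
theorem bottomRayleigh_set_bddBelow {n : ℕ} (M : Matrix (Fin n) (Fin n) ℝ) :
    BddBelow {r : ℝ | ∃ v : Fin n → ℝ, v ≠ 0 ∧ r = v ⬝ᵥ (M *ᵥ v) / (v ⬝ᵥ v)} :=
  rayleighSet_bddBelow M

/-- (c) **The Rayleigh set of `bottomRayleigh M` is non-empty in positive dimension** (`M` an `(n+1) × (n+1)` matrix — the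
constant vector `1` is non-zero; the cell's `rayleighSet_nonempty`). [folklore] -/
theorem bottomRayleigh_set_nonempty {n : ℕ} (M : Matrix (Fin (n + 1)) (Fin (n + 1)) ℝ) :
    {r : ℝ | ∃ v : Fin (n + 1) → ℝ, v ≠ 0 ∧ r = v ⬝ᵥ (M *ᵥ v) / (v ⬝ᵥ v)}.Nonempty :=
  rayleighSet_nonempty M

/-- Both at once, in the shape the side-fact ledger prints: for an `(n+1) × (n+1)` matrix the infimum in `bottomRayleigh` is
taken over a non-empty set bounded below — `ε₁` is a genuine infimum. [folklore] -/
theorem bottomRayleigh_bddBelow_nonempty {n : ℕ} (M : Matrix (Fin (n + 1)) (Fin (n + 1)) ℝ) :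
    BddBelow {r : ℝ | ∃ v : Fin (n + 1) → ℝ, v ≠ 0 ∧ r = v ⬝ᵥ (M *ᵥ v) / (v ⬝ᵥ v)} ∧
      {r : ℝ | ∃ v : Fin (n + 1) → ℝ, v ≠ 0 ∧ r = v ⬝ᵥ (M *ᵥ v) / (v ⬝ᵥ v)}.Nonempty :=
  ⟨bottomRayleigh_set_bddBelow M, bottomRayleigh_set_nonempty M⟩

/-- (c) **The orthogonal Rayleigh set inside `secondRayleigh M` is bounded below**, for every `u`, in every dimension
(the cell's `orthRayleighSet_bddBelow`). [folklore] -/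
theorem secondRayleigh_set_bddBelow {n : ℕ} (M : Matrix (Fin n) (Fin n) ℝ) (u : Fin n → ℝ) :
    BddBelow {r : ℝ | ∃ v : Fin n → ℝ, v ≠ 0 ∧ v ⬝ᵥ u = 0 ∧ r = v ⬝ᵥ (M *ᵥ v) / (v ⬝ᵥ v)} :=
  orthRayleighSet_bddBelow M u

/-- (c) **The orthogonal Rayleigh set is non-empty in dimension `≥ 2`** (`M` an `(n+1) × (n+1)` matrix with `0 < n`: every
`u` has a non-zero orthogonal vector on two coordinates; the cell's `orthRayleighSet_nonempty`). [folklore] -/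
theorem secondRayleigh_set_nonempty {n : ℕ} (hn : 0 < n) (M : Matrix (Fin (n + 1)) (Fin (n + 1)) ℝ)
    (u : Fin (n + 1) → ℝ) :
    {r : ℝ | ∃ v : Fin (n + 1) → ℝ, v ≠ 0 ∧ v ⬝ᵥ u = 0 ∧ r = v ⬝ᵥ (M *ᵥ v) / (v ⬝ᵥ v)}.Nonempty :=
  orthRayleighSet_nonempty hn M u

/-- For every `u`, in every dimension, the inner infimum of `secondRayleigh M` is `≤ Σ|M i j|`: a non-empty inner set has
infimum `≤` any of its Rayleigh quotients `≤ Σ|M i j|`, an empty one gives the default `0 ≤ Σ|M i j|`. [folklore] -/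
theorem secondRayleigh_sInf_le_entrySum {n : ℕ} (M : Matrix (Fin n) (Fin n) ℝ) (u : Fin n → ℝ) :
    sInf {r : ℝ | ∃ v : Fin n → ℝ, v ≠ 0 ∧ v ⬝ᵥ u = 0 ∧ r = v ⬝ᵥ (M *ᵥ v) / (v ⬝ᵥ v)} ≤ entrySum M := by
  by_cases hne : {r : ℝ | ∃ v : Fin n → ℝ, v ≠ 0 ∧ v ⬝ᵥ u = 0 ∧ r = v ⬝ᵥ (M *ᵥ v) / (v ⬝ᵥ v)}.Nonempty
  · obtain ⟨r, v, hv, hvu, rfl⟩ := hne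
    exact (csInf_le (orthRayleighSet_bddBelow M u) ⟨v, hv, hvu, rfl⟩).trans (rayleigh_le_entrySum M hv)
  · rw [Set.not_nonempty_iff_eq_empty.1 hne, Real.sInf_empty]
    exact entrySum_nonneg M

/-- (c) **The family under the `⨆` of `secondRayleigh M` is bounded above — in EVERY dimension**, by `Σ|M i j|`; so the `⨆`
is a genuine supremum (`le_ciSup` applies). [folklore] -/
theorem secondRayleigh_range_bddAbove {n : ℕ} (M : Matrix (Fin n) (Fin n) ℝ) :
    BddAbove (Set.range fun u : Fin n → ℝ =>
      sInf {r : ℝ | ∃ v : Fin n → ℝ, v ≠ 0 ∧ v ⬝ᵥ u = 0 ∧ r = v ⬝ᵥ (M *ᵥ v) / (v ⬝ᵥ v)}) :=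
  ⟨entrySum M, Set.forall_mem_range.2 (secondRayleigh_sInf_le_entrySum M)⟩

/-- The index type of that `⨆` is inhabited (the zero vector), so the range is non-empty. [folklore] -/
theorem secondRayleigh_range_nonempty {n : ℕ} (M : Matrix (Fin n) (Fin n) ℝ) :
    (Set.range fun u : Fin n → ℝ =>
      sInf {r : ℝ | ∃ v : Fin n → ℝ, v ≠ 0 ∧ v ⬝ᵥ u = 0 ∧ r = v ⬝ᵥ (M *ᵥ v) / (v ⬝ᵥ v)}).Nonempty :=
  Set.range_nonempty _

/-- Hence `secondRayleigh M ≤ Σ|M i j|` in every dimension. [folklore] -/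
theorem secondRayleigh_le_entrySum {n : ℕ} (M : Matrix (Fin n) (Fin n) ℝ) : secondRayleigh M ≤ entrySum M :=
  ciSup_le (secondRayleigh_sInf_le_entrySum M)

end Rayleigh

end Summit.RiemannHypothesis.RiemannHypothesis.Runbook
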